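import Summits.KontsevichZagierPeriods.KontsevichZagierPeriods.Theses.GenusOneIterated

/-!
# `DepthThreeLemniscatic` (stmt-KontsevichZagierPeriods-6777, route GenusOneIterated) — birth skeleton
(`Lines/birth.lean`, BC3 of the Lean birth certificate; skeleton-register, planner one-shot, 2026-08-17)

The crux (rank 3): at the lemniscatic curve `y² = 4x³ − 4x` (2-torsion abscissae `−1, 0, 1`; upper
arc of the real oval from `(−1,0)` to `(0,0)`; `I(w)` the iterated integral of a word in `ω = dx/y`,
`η = x dx/y` on the ordered simplex `−1 < x₀ < ⋯ < 0`, last letter on the largest variable), every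
KZ representation `r = [Δ₃, 8x₂/(y₀y₁y₂)]` (value `8·I(ωωη) = −0.48377477…`) is KZ-equivalent to
every `r' = [(−1,0)×(0,1), (4/(1+x₁) − 4/(1+x₁²))/y₀]` (value `A(4 log 2 − π)`, `A = I(ω) = ϖ/2`).

Notation for values (all along the arc): `A = I(ω) = 1.3110287771`, `B = I(η) = −0.5990701174`,
`C = I(ωη) = −0.2194122866`, `D = I(ηω) = −0.5659858768`, `X = I(ωωη) = −0.0604718466`,
`Y = I(ωηω) = −0.1667121285`, `Z = I(ηωω) = −0.2876558217`. Depth ≤ 2 is settled in the tree: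
shuffle `C + D = AB` (`EllIterRepShuffle`), Kummer `C − D = ½ log 2` (`KummerFamily`, PROVED, item
6780, at `e = (1,0,−1)`), Legendre `−4AB = π` (`LegendreLemniscatic`, PROVED, item 6781), and
`TorsionFree` (PROVED, item 3169). Modulo these, the crux `8X = A(4 log 2 − π)` is ONE new linear
relation among the three length-3 words with one `η`; the shuffles give `2X + Y = AC`, `Y + 2Z = AD`,
and the 3-dimensional reflection in the third 2-torsion point gives `X − Z = A(C − D)/2` (which is
already a consequence of the shuffles). The new relation, in its cleanest form, is the
FACTORISATION `Z = A·C`, i.e. `I(ηωω) = I(ω)·I(ωη)` (equivalently `2X + Y − Z = 0`): homogeneous of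
length three, no `π`, no `log 2` — true at the lemniscatic curve (checked here to 5e-13; it is the
70-digit-certified crux value minus proved identities) and FALSE for non-CM curves (the card's test
(T1)). This is where the cusp / B-period content of the general-modulus identity (L1) hides once
`|ω₂| = ω₁` (the real change of variables `x ↦ −x` between the twist's oval and the oval) and
Legendre have absorbed `π|ω₂|`.

The cut (four named stubs; `stub_cmEtaFirstFactorisation` is load-bearing, the other three are
certificates of the kind the tree already proves):

* `stub_reflectionDepthThree` (M–L; the route's foreseen `ReflectionDepthThree`): the involution
  `σ(x) = (x+1)/(x−1) = x(P₁ − P)` of the arc (`σ*ω = −ω`, `σ*η = −σ(x)ω`, `y(σx) = 2y(x)/(x−1)²`)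
  applied to all three variables of `Δ₃` (rule 2, `Φ(u) = (σu₂, σu₁, σu₀)`, `|det Φ′| = ∏ 2/(uᵢ−1)²`)
  turns `[Δ₃, 8x₂/(y₀y₁y₂)]` into `[Δ₃, 8σ(x₀)/(y₀y₁y₂)]`; rule 1b with
  `σ(x) − x = (−x² + 2x + 1)/(x − 1)` and the ALGEBRAIC primitive `φ = −y/(2(x−1))`,
  `φ′ = (σ(x) − x)/y`, `φ(−1) = 0`; a coordinate cycle (rule 2) and one Newton–Leibniz in the
  smallest variable (rule 3) with primitive `8φ(t)/(y₁y₂)`; pointwise `φ/y = 1/(2(1−x))`. Output: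
  `[r] − [z] − [m] ∈ KZ.relations` with `z = [Δ₃, 8x₀/(y₀y₁y₂)]` (value `8Z`) and the MIRROR-LOG
  term `m = [Δ₂, 4/((1−x₀)y₁)]` (value `2A log 2 = 1.8174718010`). The 3-dimensional twin of the
  nine-move certificate `GenusOneIterated.KummerFamily.equivalent` (Theorems, proved).
* `stub_cmEtaFirstFactorisation` (XL, LOAD-BEARING — the CM relation): `z ~ q` where
  `q = [(−1,0) × Δ₂, 8x₂/(y₀y₁y₂)]` is the product-domain representation of `8·I(ω)·I(ωη)`
  (`KZ.IntegralRep.prod` shape: first coordinate free). `I(ηωω) = I(ω)I(ωη)` holds at the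
  lemniscatic curve only; no cell or correspondence realising it is known (the route's "complex
  3-cell in E(ℂ)³ or Legendre coupling"; one candidate: Stokes for `z^k ℘(z) dz`, `k ≤ 2`, on the
  quarter-period rectangle, whose four sides are the two real branches of `E` and of its twist
  `y² = −f` and whose interior `℘` maps onto a half-plane `{Im x < 0}` — a semialgebraic 2-cell of
  `E(ℂ) ⊂ ℝ⁴` — followed by `x ↦ −x` on the twist sides (CM) and Legendre). If no chain exists this
  stub, not the bookkeeping, is the route's 'motivic but not KZ' witness for route Neg.
* `stub_productEvaluation` (L): `q ~ p = [(−1,0)×(0,1), (2/(1+x₁) − 4/(1+x₁²))/y₀]`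
  (`8AC = A(2 log 2 − π)`): `q` is `[A-arc]·[Δ₂, 8x₂/(y₀y₁)]` (`KZ.IntegralRep.prod`, `KZ.eval_mul`);
  `2[Δ₂, x₂/(y y)] = ([C] + [D]) + ([C] − [D])` with `[C] + [D] ~ [A-arc]·[η-arc]` (shuffle: square =
  two simplices, `EllIterRepShuffle`) and `[C] − [D] ~ [∫₁² du/(2u)]` (`KummerFamily` at `(1,0,−1)`,
  rule 1b); `4[A][B] ~ −[∫_ℝ dv/(1+v²)]` (`LegendreLemniscatic`) `~ −[∫₀¹ 4 dv/(1+v²)]` (rules 1a/2 on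
  `ℝ = (−∞,−1] ∪ [−1,0] ∪ [0,1] ∪ [1,∞)`, `v ↦ −v`, `v ↦ 1/v`); `u = 1 + x₁`; the factor 2 by
  `TorsionFree`; products by `KZ.mul_mem_relations_left/right`; everything lands on the common
  2-dimensional domain `(−1,0)×(0,1)` as literal product representations.
* `stub_mirrorLogEvaluation` (M): `m ~ l = [(−1,0)×(0,1), (2/(1+x₁))/y₀]` (`2A log 2`): the
  2-dimensional reflection `(x₀,x₁) ↦ (σx₁, σx₀)` of `Δ₂` carries `4/((1−x₀)y₁)` to `4/((1−x₁)y₀)`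
  (`|σ′(u)|/(1 − σ(u)) = 1/(1 − u)`), the two copies tile the square (rule 1a, null diagonal) into
  `[A-arc]·[∫_{−1}^{0} 4 du/(1−u)]`, `u ↦ −u`, and `TorsionFree` halves it (or split `Δ₂` along the
  fixed curve `x₁ = σ(x₀)` as `KummerFamily.equivalent` does, avoiding torsion).

`depthThreeLemniscatic_compose : S1 → S2 → S3 → S4 → DepthThreeLemniscatic` is a real proof: it chains
the four stub STATEMENTS, performs the final move itself (rule 1b on `(−1,0)×(0,1)`:
`(4/(1+x₁) − 4/(1+x₁²))/y₀ = (2/(1+x₁) − 4/(1+x₁²))/y₀ + (2/(1+x₁))/y₀`, an element of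
`KZ.integrandAddRel`), and closes by additive-group algebra in `KZ.FormalRep`:
`[r] − [r'] = ([r]−[z]−[m]) + ([z]−[q]) + ([q]−[p]) + ([m]−[l]) − ([r']−[p]−[l])`.
`DepthThreeLemniscatic_of : DepthThreeLemniscatic` (the registered skeleton theorem) applies it to the
four stubs by name. Sorries live ONLY in the four `stub_*` theorems.

Values (pure-python cumulative quadrature in the smooth chart `x = −cos²φ`, `dx/y = dφ/√(1+cos²φ)`,
4·10⁵ nodes, this session): `8X = −0.483774772881`, `8Z = −2.301246573904`, `m = 1.817471801023 =
2A log 2 = 8(X − Z)`, `8AC = −2.301246573898 = A(2 log 2 − π) = −2.301246573903`,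
`r' = A(4 log 2 − π) = −0.483774772880`, `2X + Y − Z = 5.1e-13`; `C + D − AB = 2.0e-12`,
`C − D − ½ log 2 = −9.1e-13`, `−4AB − π = 4.6e-14`.

Disproof used: none on record (`ledger crux ls stmt-KontsevichZagierPeriods-6777`: no workfiles, no
`Disproof.lean`, no crux ideas, 2026-08-17); the negatives index of the summit has one entry
(KinematicFormulas, plane convexity), unrelated. Barrier `noSemialgebraicPrimitive_inv_sub_two`: not
engaged — the only primitive in the certificates is the algebraic `φ = −y/(2(x−1))`; `log 2` stays
unfolded as `∫ 2/(1+x₁)`, `π` as `∫ 4/(1+x₁²)`.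

Leans on (by name): `Summit.KontsevichZagierPeriods.KontsevichZagierPeriods.Theses.GenusOneIterated.
{DepthThreeLemniscatic, KummerFamily, LegendreLemniscatic, TorsionFree}` (the last three proved:
`GenusOneIterated.KummerFamily.KummerFamily_proof`, `…LegendreLemniscatic.legendreLemniscatic_proof`,
`CoactionDevissage.TorsionFree.exceptionalCouplings_torsionFree_proof`);
`Literature.NumberTheory.Transcendental.KZ.{IntegralRep, of, relations, Equivalent,
integrandAddRel_subset_relations, changeOfVariablesRel, newtonLeibnizRel, domainAddRel,
IntegralRep.prod, eval_mul, mul_mem_relations_right_holds, ellIterRep}`, `EllIterRepShuffle`,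
`KZ.FormalPeriodRing` (`KZRulesAssociator`). References: Kontsevich–Zagier 2001 §1.2;
Lawden 1989 §6.12; arXiv:1301.3042; arXiv:1509.08760; Chudnovsky 1976.
-/

noncomputable section

namespace Summit.KontsevichZagierPeriods.GenusOneIterated.DepthThreeLemniscatic.Birth

open Summit.KontsevichZagierPeriods.KontsevichZagierPeriods.Theses.GenusOneIterated (DepthThreeLemniscatic)
open Literature.NumberTheory.Transcendental

/-- **Stub R — `reflectionDepthThree` (M–L; the 3-dimensional reflection certificate).** For every
KZ representation `r` of `8·I(ωωη)` on `Δ₃ = {−1 < x₀ < x₁ < x₂ < 0}` there are representations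
`z = [Δ₃, 8x₀/(y₀y₁y₂)]` (`8·I(ηωω)`) and `m = [Δ₂, 4/((1−x₀)y₁)]` (the mirror-log term, value
`2A log 2`) with `[r] − [z] − [m] ∈ KZ.relations`: rule 2 along `Φ(u) = (σu₂, σu₁, σu₀)`,
`σ(x) = (x+1)/(x−1)`; rule 1b with `σ(x₀) = x₀ + (σ(x₀) − x₀)` and `(σ(x) − x)/y = φ′(x)`,
`φ = −y/(2(x−1))`; a coordinate cycle; rule 3 in the smallest variable with the algebraic primitive
`8φ(t)/(y₁y₂)`, `φ(−1) = 0`; pointwise `φ(x)/y(x) = 1/(2(1−x))`. (`z`, `m` exist e.g. as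
`8 • ellIterRep` of the word `ηωω` and by `KZ.IntegralRep.ofRational`-type constructions; their
integrands are dominated by `8/(y₀y₁y₂)` resp. `4/y₁` on bounded sets.)
[KontsevichZagier2001 §1.2 rules (1)–(3); Lawden1989 §6.12; SilvermanAEC2009 III.2.3] -/
theorem stub_reflectionDepthThree :
    ∀ (r : Literature.NumberTheory.Transcendental.KZ.IntegralRep 3), r.domain = {x | -1 < x 0 ∧ x 0 < x 1 ∧ x 1 < x 2 ∧ x 2 < 0} → Set.EqOn r.integrand (fun x => 8 * x 2 / (Real.sqrt (4 * x 0 ^ 3 - 4 * x 0) * Real.sqrt (4 * x 1 ^ 3 - 4 * x 1) * Real.sqrt (4 * x 2 ^ 3 - 4 * x 2))) r.domain → ∃ (z : Literature.NumberTheory.Transcendental.KZ.IntegralRep 3) (m : Literature.NumberTheory.Transcendental.KZ.IntegralRep 2), z.domain = {x | -1 < x 0 ∧ x 0 < x 1 ∧ x 1 < x 2 ∧ x 2 < 0} ∧ Set.EqOn z.integrand (fun x => 8 * x 0 / (Real.sqrt (4 * x 0 ^ 3 - 4 * x 0) * Real.sqrt (4 * x 1 ^ 3 - 4 * x 1) *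 Real.sqrt (4 * x 2 ^ 3 - 4 * x 2))) z.domain ∧ m.domain = {x | -1 < x 0 ∧ x 0 < x 1 ∧ x 1 < 0} ∧ Set.EqOn m.integrand (fun x => 4 / ((1 - x 0) * Real.sqrt (4 * x 1 ^ 3 - 4 * x 1))) m.domain ∧ Literature.NumberTheory.Transcendental.KZ.of r - Literature.NumberTheory.Transcendental.KZ.of z - Literature.NumberTheory.Transcendental.KZ.of m ∈ Literature.NumberTheory.Transcendental.KZ.relations := by
  sorry

/-- **Stub F — `cmEtaFirstFactorisation` (XL, LOAD-BEARING; the CM relation of length three).**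
`[Δ₃, 8x₀/(y₀y₁y₂)] ~ [(−1,0) × Δ₂, 8x₂/(y₀y₁y₂)]`, i.e. `I(ηωω) = I(ω)·I(ωη)` as a
KZ-equivalence at the lemniscatic curve (values `8Z = 8AC = −2.3012465739`; equivalently
`2·I(ωωη) + I(ωηω) − I(ηωω) = 0`). True here only because of complex multiplication by `i`
(`|ω₂| = ω₁`, `η₁ω₁ = π`); false on non-CM curves. No move chain is known: candidates are a Stokes
cell for `z^k℘(z)dz` (`k ≤ 2`) over the half-plane cell `{Im x < 0} ⊂ E(ℂ) ⊂ ℝ⁴` bounded by the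
four real branches of `E` and its twist, plus `x ↦ −x` on the twist and Legendre; or a
correspondence chain for `[i]`. If it has none, this is the route's 'motivic but not KZ' witness.
[arXiv:1301.3042 §2.4; arXiv:1509.08760; Lawden1989 Ch. 6; Chudnovsky1976; KontsevichZagier2001 §1.2] -/
theorem stub_cmEtaFirstFactorisation :
    ∀ (z : Literature.NumberTheory.Transcendental.KZ.IntegralRep 3), z.domain = {x | -1 < x 0 ∧ x 0 < x 1 ∧ x 1 < x 2 ∧ x 2 < 0} → Set.EqOn z.integrand (fun x => 8 * x 0 / (Real.sqrt (4 * x 0 ^ 3 - 4 * x 0) * Real.sqrt (4 * x 1 ^ 3 - 4 * x 1) * Real.sqrt (4 * x 2 ^ 3 - 4 * x 2))) z.domain → ∃ (q : Literature.NumberTheory.Transcendental.KZ.IntegralRep 3), q.domain = {x | -1 < x 0 ∧ x 0 < 0 ∧ -1 < x 1 ∧ x 1 < x 2 ∧ x 2 < 0} ∧ Set.EqOn q.integrand (fun x => 8 * x 2 / (Real.sqrt (4 * x 0 ^ 3 - 4 * x 0) * Real.sqrt (4 * x 1 ^ 3 - 4 * x 1) * Real.sqrt (4 * x 2 ^ 3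 - 4 * x 2))) q.domain ∧ Literature.NumberTheory.Transcendental.KZ.Equivalent z q := by
  sorry

/-- **Stub P — `productEvaluation` (L; depth ≤ 2 bookkeeping with three PROVED route items).**
`[(−1,0) × Δ₂, 8x₂/(y₀y₁y₂)] ~ [(−1,0)×(0,1), (2/(1+x₁) − 4/(1+x₁²))/y₀]` (`8AC = A(2 log 2 − π)`):
the product shape `[A-arc]·[Δ₂, 8x₂/(y₀y₁)]` (`KZ.IntegralRep.prod`), `2[C] = ([C]+[D]) + ([C]−[D])`,
shuffle `[C] + [D] ~ [A-arc]·[η-arc]` (`EllIterRepShuffle`), Kummer `[C] − [D] ~ [∫₁² du/(2u)]`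
(`KummerFamily` at `e = (1,0,−1)`, proved), Legendre `4[A][B] ~ −[∫_ℝ dv/(1+v²)] ~ −[∫₀¹ 4dv/(1+v²)]`
(`LegendreLemniscatic`, proved; rules 1a/2 on `ℝ`), `u = 1 + x₁`, the ideal property
`KZ.mul_mem_relations_*`, and `TorsionFree` (proved) for the factor `2`.
[KontsevichZagier2001 §1.2, §4.1; MckeanMoll1999; Lawden1989 §6.12] -/
theorem stub_productEvaluation :
    ∀ (q : Literature.NumberTheory.Transcendental.KZ.IntegralRep 3), q.domain = {x | -1 < x 0 ∧ x 0 < 0 ∧ -1 < x 1 ∧ x 1 < x 2 ∧ x 2 < 0} → Set.EqOn q.integrand (fun x => 8 * x 2 / (Real.sqrt (4 * x 0 ^ 3 - 4 * x 0) * Real.sqrt (4 * x 1 ^ 3 - 4 * x 1) * Real.sqrt (4 * x 2 ^ 3 - 4 * x 2))) q.domain → ∃ (p : Literature.NumberTheory.Transcendental.KZ.IntegralRep 2), p.domain = {x | -1 < x 0 ∧ x 0 < 0 ∧ 0 < x 1 ∧ x 1 < 1} ∧ Set.EqOn p.integrand (fun x => (2 / (1 + x 1) - 4 / (1 + x 1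 ^ 2)) / Real.sqrt (4 * x 0 ^ 3 - 4 * x 0)) p.domain ∧ Literature.NumberTheory.Transcendental.KZ.Equivalent q p := by
  sorry

/-- **Stub M — `mirrorLogEvaluation` (M).** `[Δ₂, 4/((1−x₀)y₁)] ~ [(−1,0)×(0,1), (2/(1+x₁))/y₀]`
(both `2A log 2 = 1.8174718010`): the reflection `(x₀,x₁) ↦ (σx₁, σx₀)` of `Δ₂` (rule 2;
`|σ′(u)|/(1 − σ(u)) = 1/(1 − u)`, `1/y(σu)·|σ′(u)| = 1/y(u)`) gives the mirror simplex with
integrand `4/((1−x₁)y₀)`; the two tile the square `(−1,0)²` (rule 1a, null diagonal) into the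
product `[A-arc]·[∫_{−1}^0 4du/(1−u)]`, `u ↦ −u` (rule 2), and `TorsionFree` halves — or split `Δ₂`
along the fixed curve `x₁ = σ(x₀)` as in `KummerFamily.equivalent` to avoid torsion. No
transcendental primitive is used (barrier `noSemialgebraicPrimitive_inv_sub_two` not engaged).
[KontsevichZagier2001 §1.2 rules (1)–(2)] -/
theorem stub_mirrorLogEvaluation :
    ∀ (m : Literature.NumberTheory.Transcendental.KZ.IntegralRep 2), m.domain = {x | -1 < x 0 ∧ x 0 < x 1 ∧ x 1 < 0} → Set.EqOn m.integrand (fun x => 4 / ((1 - x 0) * Real.sqrt (4 * x 1 ^ 3 - 4 * x 1))) m.domain → ∃ (l : Literature.NumberTheory.Transcendental.KZ.IntegralRep 2), l.domain = {x | -1 < x 0 ∧ x 0 < 0 ∧ 0 < x 1 ∧ x 1 < 1} ∧ Set.EqOn l.integrand (fun x => (2 / (1 + x 1)) / Real.sqrt (4 * x 0 ^ 3 - 4 * x 0)) l.domain ∧ Literature.NumberTheory.Transcendental.KZ.Equivalent m l := by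
  sorry

set_option linter.defProp false in
/-- **Composition (hypotheses form, real proof).** The four stub STATEMENTS imply the crux BY NAME:
chain `r ↦ (z, m)` (R), `z ↦ q` (F), `q ↦ p` (P), `m ↦ l` (M); the last move — rule 1b on the
common domain `(−1,0)×(0,1)`, `(4/(1+x₁) − 4/(1+x₁²))/y₀ = (2/(1+x₁) − 4/(1+x₁²))/y₀ + (2/(1+x₁))/y₀`
— is performed here as an element of `KZ.integrandAddRel`; then
`[r] − [r'] = ([r]−[z]−[m]) + ([z]−[q]) + ([q]−[p]) + ([m]−[l]) − ([r']−[p]−[l])` in `KZ.FormalRep`.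
Sorry-free; axioms `propext`, `Classical.choice`, `Quot.sound` only. Declared as a `def` (of a
`Prop`-valued Pi type) so that `DepthThreeLemniscatic_of` below is the unique theorem concluding the
crux, as the skeleton registrar requires (pattern of `Cruxes/TypeOneIdentities/Lines/birth.lean`).
[KontsevichZagier2001 §1.2] -/
def depthThreeLemniscatic_compose :
    (∀ (r : Literature.NumberTheory.Transcendental.KZ.IntegralRep 3), r.domain = {x | -1 < x 0 ∧ x 0 < x 1 ∧ x 1 < x 2 ∧ x 2 < 0} → Set.EqOn r.integrand (fun x => 8 * x 2 / (Real.sqrt (4 * x 0 ^ 3 - 4 * x 0) * Real.sqrt (4 * x 1 ^ 3 - 4 * x 1) * Real.sqrt (4 * x 2 ^ 3 - 4 * x 2))) r.domain → ∃ (z : Literature.NumberTheory.Transcendental.KZ.IntegralRep 3) (m : Literature.NumberTheory.Transcendental.KZ.IntegralRep 2), z.domain = {x | -1 < x 0 ∧ x 0 < x 1 ∧ x 1 < x 2 ∧ x 2 < 0} ∧ Set.EqOn z.integrand (fun x => 8 * x 0 / (Real.sqrt (4 * x 0 ^ 3 - 4 * x 0) * Real.sqrt (4 * x 1 ^ 3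 - 4 * x 1) * Real.sqrt (4 * x 2 ^ 3 - 4 * x 2))) z.domain ∧ m.domain = {x | -1 < x 0 ∧ x 0 < x 1 ∧ x 1 < 0} ∧ Set.EqOn m.integrand (fun x => 4 / ((1 - x 0) * Real.sqrt (4 * x 1 ^ 3 - 4 * x 1))) m.domain ∧ Literature.NumberTheory.Transcendental.KZ.of r - Literature.NumberTheory.Transcendental.KZ.of z - Literature.NumberTheory.Transcendental.KZ.of m ∈ Literature.NumberTheory.Transcendental.KZ.relations) →
    (∀ (z : Literature.NumberTheory.Transcendental.KZ.IntegralRep 3), z.domain = {x | -1 < x 0 ∧ x 0 < x 1 ∧ x 1 < x 2 ∧ x 2 < 0} → Set.EqOn z.integrand (fun x => 8 * x 0 / (Real.sqrt (4 * x 0 ^ 3 - 4 * x 0) * Real.sqrt (4 * x 1 ^ 3 - 4 * x 1) * Real.sqrt (4 * x 2 ^ 3 - 4 * x 2))) z.domain → ∃ (q : Literature.NumberTheory.Transcendental.KZ.IntegralRep 3), q.domain = {x | -1 < x 0 ∧ x 0 < 0 ∧ -1 < x 1 ∧ x 1 < x 2 ∧ x 2 < 0} ∧ Set.EqOn q.integrand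 (fun x => 8 * x 2 / (Real.sqrt (4 * x 0 ^ 3 - 4 * x 0) * Real.sqrt (4 * x 1 ^ 3 - 4 * x 1) * Real.sqrt (4 * x 2 ^ 3 - 4 * x 2))) q.domain ∧ Literature.NumberTheory.Transcendental.KZ.Equivalent z q) →
    (∀ (q : Literature.NumberTheory.Transcendental.KZ.IntegralRep 3), q.domain = {x | -1 < x 0 ∧ x 0 < 0 ∧ -1 < x 1 ∧ x 1 < x 2 ∧ x 2 < 0} → Set.EqOn q.integrand (fun x => 8 * x 2 / (Real.sqrt (4 * x 0 ^ 3 - 4 * x 0) * Real.sqrt (4 * x 1 ^ 3 - 4 * x 1) * Real.sqrt (4 * x 2 ^ 3 - 4 * x 2))) q.domain → ∃ (p : Literature.NumberTheory.Transcendental.KZ.IntegralRep 2), p.domain = {x | -1 < x 0 ∧ x 0 < 0 ∧ 0 < x 1 ∧ x 1 < 1} ∧ Set.EqOn p.integrand (fun x => (2 / (1 + x 1) - 4 / (1 + x 1 ^ 2)) / Real.sqrt (4 * x 0 ^ 3 - 4 * x 0)) p.domain ∧ Literature.NumberTheory.Transcendental.KZ.Equivalent q p) →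
    (∀ (m : Literature.NumberTheory.Transcendental.KZ.IntegralRep 2), m.domain = {x | -1 < x 0 ∧ x 0 < x 1 ∧ x 1 < 0} → Set.EqOn m.integrand (fun x => 4 / ((1 - x 0) * Real.sqrt (4 * x 1 ^ 3 - 4 * x 1))) m.domain → ∃ (l : Literature.NumberTheory.Transcendental.KZ.IntegralRep 2), l.domain = {x | -1 < x 0 ∧ x 0 < 0 ∧ 0 < x 1 ∧ x 1 < 1} ∧ Set.EqOn l.integrand (fun x => (2 / (1 + x 1)) / Real.sqrt (4 * x 0 ^ 3 - 4 * x 0)) l.domain ∧ Literature.NumberTheory.Transcendental.KZ.Equivalent m l) →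
    DepthThreeLemniscatic := by
  intro hR hF hP hM r r' hrd hri hr'd hr'i
  obtain ⟨z, m, hzd, hzi, hmd, hmi, h1⟩ := hR r hrd hri
  obtain ⟨q, hqd, hqi, h2⟩ := hF z hzd hzi
  obtain ⟨p, hpd, hpi, h3⟩ := hP q hqd hqi
  obtain ⟨l, hld, hli, h4⟩ := hM m hmd hmi
  have h2' : KZ.of z - KZ.of q ∈ KZ.relations := h2
  have h3' : KZ.of q - KZ.of p ∈ KZ.relations := h3
  have h4' : KZ.of m - KZ.of l ∈ KZ.relations := h4
  -- the final move: integrand additivity (rule 1b) on the common domain (−1,0)×(0,1)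
  have h5 : KZ.of r' - KZ.of p - KZ.of l ∈ KZ.relations := by
    refine KZ.integrandAddRel_subset_relations ?_
    refine ⟨2, r', p, l, ?_, ?_, ?_, rfl⟩
    · rw [hpd, hr'd]
    · rw [hld, hr'd]
    · intro x hx
      have hxp : x ∈ p.domain := by
        rw [hpd]; rw [hr'd] at hx; exact hx
      have hxl : x ∈ l.domain := by
        rw [hld]; rw [hr'd] at hx; exact hx
      simp only [Pi.add_apply, hr'i hx, hpi hxp, hli hxl]
      ring
  have key : KZ.of r - KZ.of r' =
      (KZ.of r - KZ.of z - KZ.of m) + (KZ.of z - KZ.of q) + (KZ.of q - KZ.of p) +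
        (KZ.of m - KZ.of l) - (KZ.of r' - KZ.of p - KZ.of l) := by
    abel
  show KZ.of r - KZ.of r' ∈ KZ.relations
  rw [key]
  exact sub_mem (add_mem (add_mem (add_mem h1 h2') h3') h4') h5

/-- **Skeleton theorem (registered form).** The crux `DepthThreeLemniscatic` BY NAME from the four
declared stubs, via the sorry-free composition `depthThreeLemniscatic_compose` applied to
`stub_reflectionDepthThree`, `stub_cmEtaFirstFactorisation`, `stub_productEvaluation`,
`stub_mirrorLogEvaluation`; `sorry` occurs only inside those four stubs. [KontsevichZagier2001 §1.2] -/
theorem DepthThreeLemniscatic_of : DepthThreeLemniscatic :=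
  depthThreeLemniscatic_compose stub_reflectionDepthThree stub_cmEtaFirstFactorisation
    stub_productEvaluation stub_mirrorLogEvaluation

end Summit.KontsevichZagierPeriods.GenusOneIterated.DepthThreeLemniscatic.Birth

end
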